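import Mathlib
import Summits.Ventures.HodgeRepro.Tier4.Line1.RTFSetting
import Summits.Ventures.HodgeRepro.Tier4.Line1.KernelUnfold
import Summits.Ventures.HodgeRepro.Tier4.Line1.InnerBridge

/-!
# Tier4/Line4/AdaptedONBConj — complex conjugation carries invariant subspaces, irreducibility and adapted ONBs

Blind re-derivation cell `pub-hodge-repro`, Tier 4 «prove the step» (README §9–§10), seat t4-L4-p1 (prover, LINE L4,
gen 3; self-pointed cut S13497).  Tree path `lean/Summits/Ventures/HodgeRepro/Tier4/Line4/AdaptedONBConj.lean`.
Mathlib-level; no literature.  Generic over any `S : RTF.Setting G` (L1's vocabulary, `Line1/RTFSetting`).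

WHAT IS PROVED.  For the pointwise conjugation `ψ ↦ conj ∘ ψ` of functions on `G`: `S.R f (conj ∘ ψ) = conj ∘ S.R (f̄) ψ`
(`R_conj`), `S.inner (conj ∘ ψ) (conj ∘ ψ') = conj (S.inner ψ ψ')` (`inner_conj_conj`), the conjugate image of an
invariant subspace is an invariant subspace (`isInvariantSubspace_conj`), of an irreducible one is irreducible
(`isIrreducible_conj`), and — the statement LINE L4's W3Reduction consumes — the conjugate of an adapted ONB is an
adapted ONB (`isAdaptedONB_conj`: constituents `conj '' τ m`, basis `conj ∘ φ j`, same index map `n`).  Why: L1's kernel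
expansion conjugates the `T`-slot, so W3Reduction's blocks are the CONJUGATE blocks of the ONB (t4-L1-p5, S13397).

HC_CM is NOT proved by anyone in this repository.
-/

set_option autoImplicit false

noncomputable section

namespace Summit.Ventures.HodgeRepro.Tier4.Line4

open Summit.Ventures.HodgeRepro.Tier4.Line1 MeasureTheory Topology
open scoped ComplexConjugate InnerProductSpace

variable {G : Type} [Group G] [TopologicalSpace G] [IsTopologicalGroup G] [MeasurableSpace G]
  [BorelSpace G]

variable (S : RTF.Setting G)

section Conj

omit [IsTopologicalGroup G] [BorelSpace G] in
/-- Conjugation commutes with the right-regular action up to conjugating the test function. -/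
theorem R_conj (f ψ : G → ℂ) :
    S.R f (fun x => conj (ψ x)) = fun x => conj (S.R (RTF.cj f) ψ x) := by
  funext x
  simp only [RTF.Setting.R, RTF.cj]
  rw [← integral_conj]
  congr 1
  funext g
  simp only [map_mul, Complex.conj_conj]

omit [IsTopologicalGroup G] [BorelSpace G] in
/-- `S.inner` of two conjugates is the conjugate of `S.inner`. -/
theorem inner_conj_conj (ψ ψ' : G → ℂ) :
    S.inner (fun x => conj (ψ x)) (fun x => conj (ψ' x)) = conj (S.inner ψ ψ') := by
  simp only [RTF.Setting.inner]
  rw [← integral_conj]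
  congr 1
  funext x
  simp only [map_mul, Complex.conj_conj]

omit [IsTopologicalGroup G] [BorelSpace G] in
/-- `S.inner (conj ∘ ψ) φ = conj (S.inner ψ (conj ∘ φ))`. -/
theorem inner_conj_left (ψ φ : G → ℂ) :
    S.inner (fun x => conj (ψ x)) φ = conj (S.inner ψ (fun x => conj (φ x))) := by
  simp only [RTF.Setting.inner]
  rw [← integral_conj]
  congr 1
  funext x
  simp only [map_mul, Complex.conj_conj]

omit [IsTopologicalGroup G] [BorelSpace G] in
/-- The conjugate of an invariant function is invariant. -/
theorem invariant_conj {ψ : G → ℂ} (h : S.Invariant ψ) : S.Invariant (fun x => conj (ψ x)) :=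
  fun γ x => by simp only [h γ x]

omit [IsTopologicalGroup G] [BorelSpace G] in
/-- The conjugate image of an invariant subspace is an invariant subspace. -/
theorem isInvariantSubspace_conj {V : Set (G → ℂ)} (hV : S.IsInvariantSubspace V) :
    S.IsInvariantSubspace ((fun ψ : G → ℂ => fun x => conj (ψ x)) '' V) := by
  refine ⟨?_, ?_, ?_, ?_, ?_, ?_⟩
  · rintro _ ⟨ψ, hψ, rfl⟩
    exact invariant_conj S (hV.inv ψ hψ)
  · rintro _ ⟨ψ, hψ, rfl⟩
    exact Complex.continuous_conj.comp (hV.cont ψ hψ)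
  · rintro _ ⟨ψ, hψ, rfl⟩ g
    exact ⟨fun x => ψ (x * g), hV.right ψ hψ g, rfl⟩
  · rintro _ ⟨ψ, hψ, rfl⟩ _ ⟨ψ', hψ', rfl⟩
    refine ⟨fun x => ψ x + ψ' x, hV.add ψ hψ ψ' hψ', ?_⟩
    funext x
    simp only [map_add]
  · rintro _ ⟨ψ, hψ, rfl⟩ c
    refine ⟨fun x => conj c * ψ x, hV.smul ψ hψ (conj c), ?_⟩
    funext x
    simp only [map_mul, Complex.conj_conj]
  · rintro _ ⟨ψ, hψ, rfl⟩ f hf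
    refine ⟨S.R (RTF.cj f) ψ, hV.conv ψ hψ _ hf.cj, ?_⟩
    exact (R_conj S f ψ).symm

omit [Group G] [TopologicalSpace G] [IsTopologicalGroup G] [MeasurableSpace G] [BorelSpace G] in
/-- Conjugation is an involution on sets of functions. -/
theorem conj_image_conj_image (V : Set (G → ℂ)) :
    (fun ψ : G → ℂ => fun x => conj (ψ x)) '' ((fun ψ : G → ℂ => fun x => conj (ψ x)) '' V) = V := by
  ext ψ
  constructor
  · rintro ⟨_, ⟨ψ₀, hψ₀, rfl⟩, rfl⟩
    simpa [Complex.conj_conj] using hψ₀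
  · intro hψ
    refine ⟨fun x => conj (ψ x), ⟨ψ, hψ, rfl⟩, ?_⟩
    funext x
    simp only [Complex.conj_conj]

omit [IsTopologicalGroup G] [BorelSpace G] in
/-- The `L²(DG)`-seminorm of a conjugated difference is that of the difference. -/
theorem eLpNorm_conj_sub (ψ ψ' : G → ℂ) :
    eLpNorm (fun x => conj (ψ x) - conj (ψ' x)) 2 (S.μ.restrict S.DG) =
      eLpNorm (fun x => ψ x - ψ' x) 2 (S.μ.restrict S.DG) := by
  apply eLpNorm_congr_norm_ae
  refine Filter.Eventually.of_forall fun x => ?_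
  rw [← map_sub, RCLike.norm_conj]

omit [IsTopologicalGroup G] [BorelSpace G] in
/-- The conjugate image of an irreducible invariant subspace is irreducible. -/
theorem isIrreducible_conj {V : Set (G → ℂ)} (hirr : S.IsIrreducible V) :
    S.IsIrreducible ((fun ψ : G → ℂ => fun x => conj (ψ x)) '' V) := by
  intro V' hV' hsub
  have hsub' : (fun ψ : G → ℂ => fun x => conj (ψ x)) '' V' ⊆ V := by
    rw [← conj_image_conj_image V]
    exact Set.image_mono hsub
  rcases hirr _ (isInvariantSubspace_conj S hV') hsub' with h0 | hdense
  · left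
    intro ψ hψ x
    have := h0 _ ⟨ψ, hψ, rfl⟩ x
    simpa using this
  · right
    rintro _ ⟨ψ₀, hψ₀, rfl⟩ ε hε
    obtain ⟨_, ⟨ψ₂, hψ₂, rfl⟩, hlt⟩ := hdense ψ₀ hψ₀ ε hε
    refine ⟨ψ₂, hψ₂, ?_⟩
    have e : (fun x => conj (ψ₀ x) - ψ₂ x) = fun x => conj (ψ₀ x) - conj (conj (ψ₂ x)) := by
      funext x
      simp only [Complex.conj_conj]
    rw [e, eLpNorm_conj_sub]
    exact hlt

omit [IsTopologicalGroup G] [BorelSpace G] in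
/-- **The conjugate of an adapted ONB is an adapted ONB** (constituents `conj '' τ m`, basis `conj ∘ φ j`, same `n`). -/
theorem isAdaptedONB_conj {τ : ℕ → Set (G → ℂ)} {φ : ℕ → G → ℂ} {n : ℕ → ℕ} (hB : S.IsAdaptedONB τ φ n) :
    S.IsAdaptedONB (fun m => (fun ψ : G → ℂ => fun x => conj (ψ x)) '' τ m) (fun j x => conj (φ j x)) n := by
  refine ⟨fun m => isInvariantSubspace_conj S (hB.inv m), fun m => isIrreducible_conj S (hB.irred m),
    ?_, fun j => ⟨φ j, hB.mem j, rfl⟩, fun j j' => ?_, fun ψ hψ hperp => ?_⟩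
  · rintro m m' hne _ ⟨ψ, hψ, rfl⟩ _ ⟨ψ', hψ', rfl⟩
    rw [inner_conj_conj, hB.orthSub m m' hne ψ hψ ψ' hψ', map_zero]
  · rw [inner_conj_conj, hB.orth j j']
    split_ifs <;> simp
  · -- completeness: the conjugate of `ψ` is orthogonal to every `φ j`
    have hψ' : MemLp (fun x => conj (ψ x)) 2 (S.μ.restrict S.DG) := hψ.star
    have hperp' : ∀ j, S.inner (fun x => conj (ψ x)) (φ j) = 0 := fun j => by
      rw [inner_conj_left, hperp j, map_zero]
    have h0 := hB.complete _ hψ' hperp'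
    filter_upwards [h0] with x hx
    simpa using hx

end Conj

end Summit.Ventures.HodgeRepro.Tier4.Line4

end
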